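import Summits.HodgeConjecture.CorCM.QuarticCMSubfieldOfOcticHodge
import Summits.HodgeConjecture.CorCM.CyclicCMSurfaceTimesCMHodge
import Literature.NumberTheory.ComplexMultiplication.CMTypeRankQuadraticTowerDegenerate
import HarnessLib

/-!
# The REFLEX field of a non-Galois quartic CM field inside a non-Galois octic CM field: the pair `S × F` is decided by
# the TYPES — degenerate iff the reflex field of `(K_S, Φ_S)` sits on the unsplit side of `Φ_F`

COR-CM (cell `pub-hodgecm2`, binder seat `b16` gen 40, count-neutral claim SxF-ONECONJ (F5)); NEW as stated, hence under
`Summits/`.  Theorems only; no definition, no named fact, no `sorry`.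

Setting: `K_{i₀}` a NON-Galois quartic CM field (Galois closure `L` of degree `8`, dihedral), `M` the OTHER quartic CM
class of `L` — a non-Galois quartic CM field with the same Galois closure in `ℂ` and not isomorphic to `K_{i₀}` (the
reflex field of every type of `K_{i₀}`) — and `K_{i₁}` a NON-Galois octic CM field containing `M` (`e : M → K_{i₁}`).
For a type `Θ = Φ_{i₁}` and an embedding `ψ₀ : M → ℂ` call `ψ₀` UNSPLIT if its two extensions to `K_{i₁}` lie on the
same side of `Θ`; a nondegenerate `Θ` has exactly one unsplit conjugate pair `{ψ₀, ψ̄₀}` (Kubota).  The four types of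
`K_{i₀}` fall into two complex-conjugacy classes, and the stabiliser of `ψ₀` in `Aut(ℂ)` (a reflection of the dihedral
group) stabilises the two types of ONE class and swaps the two of the other — equivalently: the reflex field of
`(K_{i₀}, Ψ)` is `ψ₀(M)` for the first class and `\overline{ψ₁}(M) ≠ ψ₀(M)` for the second.

> **Theorem** (`isNondegenerateFamily_iff_of_reflexSubfield`).  With `ψ₀` unsplit for `Φ_{i₁}`:
> `(Φ_{i₀}, Φ_{i₁})` is nondegenerate **iff** `Φ_{i₁}` is nondegenerate AND some automorphism of `ℂ` fixing `ψ₀`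
> moves `Φ_{i₀}`.  In the other case (`Stab(ψ₀)` stabilises `Φ_{i₀}`) the pair is DEGENERATE for every `Φ_{i₁}`:
> `rank(Φ_{i₀}, Φ_{i₁}) = rank(Φ_{i₁})`.

So for a simple CM abelian surface `S` of dihedral type and a simple CM fourfold `F` whose field contains the reflex
field of `S`, `B• = D•` on all `S^a × F^b` for the surfaces of one conjugacy class of types and FAILS (exceptional Hodge
classes) for the other: the smallest pair of simple CM abelian varieties whose stable Hodge conjecture status is decided by
the types and not by the fields (dimensions `(1, g)`, `(2, 2)`, `(2, 3)` and the configurations `K_S ⊄ L_F`, `K_S ⊂ K_F`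
are field criteria: `ForeignQuadraticCMFieldsHodge`, `SimpleCMSurfaceTimesCMHodge`, `CyclicCMSurfaceTimesCMHodge`,
`QuarticCMSubfieldOfOcticHodge`).  Mechanisms: the NONDEGENERATE half is stabiliser separation with the separating element
taken from `Stab(ψ₀)` (`exists_typeStab_and_not_of_quadraticTower_of_smul_eq`); the DEGENERATE half is the incidence
transfer `CMTypeRankQuadraticTowerDegenerate` (the `i₁`-restriction is injective on `U(Σ)`).

## References

* [MoonenZarhin1999LowDim] B. Moonen, Yu. Zarhin, *Hodge classes on abelian varieties of low dimension*, Math. Ann.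
  315 (1999), "Hodge groups of simple abelian surfaces of CM-type"; Thm. (0.2).
* [Gordon1999HodgeAVSurvey] B. B. Gordon, *A survey of the Hodge conjecture for abelian varieties*, 7.5–7.7, 10.10.
* [Shimura1998] G. Shimura, *Abelian Varieties with Complex Multiplication and Modular Functions*, §8.3 Prop. 28, §8.4
  Example (2)(C) (reflex fields of non-Galois quartic CM fields).
* [Kubota1965] T. Kubota, *On the field extension by complex multiplication*, §2.
-/

noncomputable section

open CategoryTheory CategoryTheory.Limits NumberField NumberField.ComplexEmbedding IntermediateField Module
open scoped BigOperators

namespace Summit.HodgeConjecture.CorCM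

open Literature.NumberTheory.ComplexMultiplication
open Literature.AlgebraicGeometry.Motives (AbelianVariety CMType)
open Literature.AlgebraicGeometry.HodgeTheory
open Literature.AlgebraicGeometry.ComplexMultiplication (IsCMTypeRealisation isSimple_iff_isPrimitive)
open Literature.AlgebraicGeometry.VanGeemen1994 (hodgeClassSpan)
open Literature.AlgebraicGeometry.Pohlmann1968
open Literature.Barriers.HodgeConjecture (divisorClassesSpan)

/-! ## §1 Bookkeeping for the third field `M` -/

section Fields

variable {M K₀ L : Type} [Field M] [NumberField M] [IsCMField M] [Field K₀] [NumberField K₀] [Field L]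
  [NumberField L] [IsCMField L]

omit [IsCMField M] in
/-- **Same Galois closure ⟹ automorphisms trivial on `Hom(M, ℂ)` are trivial on `Hom(K₀, ℂ)`.**
[cite: Lang2002, V §3 Thm. 3.3] -/
theorem forall_smul_eq_of_forall_smul_eq_of_normalClosure_eq
    (hLL : normalClosure ℚ M ℂ = normalClosure ℚ K₀ ℂ) {n : ℂ ≃+* ℂ} (hn : ∀ x : M →+* ℂ, n • x = x)
    (z : K₀ →+* ℂ) : n • z = z := by
  refine RingHom.ext fun w => ?_
  rw [ringEquiv_smul_apply]
  have hmem : z w ∈ normalClosure ℚ M ℂ := hLL ▸ apply_mem_normalClosure (I := Unit) (K := fun _ => K₀) () z w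
  have h1 := apply_eq_of_forall_smul_eq (I := Unit) (K := fun _ => M) () (σ := n) (σ' := 1)
    (fun s => by rw [one_smul]; exact hn s) hmem
  simpa using h1

/-- `h` fixes `ψ̄₀` iff it fixes `ψ₀`. [folklore] -/
theorem smul_conj_smul_eq_iff (h : ℂ ≃+* ℂ) (ψ₀ : M →+* ℂ) :
    h • ((starRingAut : ℂ ≃+* ℂ) • ψ₀) = (starRingAut : ℂ ≃+* ℂ) • ψ₀ ↔ h • ψ₀ = ψ₀ := by
  rw [conj_smul_eq_conjugate, QuarticCM.smul_conjugate]
  exact ⟨fun h1 => (ComplexEmbedding.involutive_conjugate M).injective h1, fun h1 => by rw [h1]⟩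

omit [IsCMField M] in
/-- **Unsplit embeddings come in conjugate pairs and carry a full fibre inside `Θ`**: if the fibre of `ψ₀` is unsplit
for `Θ` then over `ψ₀` or over `ψ̄₀` the whole fibre lies in `Θ`. [cite: Shimura1998, §18.1] -/
theorem exists_fibre_subset_of_unsplit (e : M →+* L) (h2 : finrank ℚ L = 2 * finrank ℚ M) (Θ : CMType L)
    {ψ₀ : M →+* ℂ} (hψ₀ : ∀ y y' : L →+* ℂ, y.comp e = ψ₀ → y'.comp e = ψ₀ → (y ∈ Θ.1 ↔ y' ∈ Θ.1)) :
    ∃ y₀ : L →+* ℂ, (∀ y : L →+* ℂ, y.comp e = y₀.comp e → y ∈ Θ.1) ∧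
      (y₀.comp e = ψ₀ ∨ y₀.comp e = (starRingAut : ℂ ≃+* ℂ) • ψ₀) := by
  classical
  -- some `y` over `ψ₀`
  have hcard := card_filter_comp_eq_mul_finrank e ψ₀
  rw [h2] at hcard
  have hpos : 0 < (Finset.univ.filter fun y : L →+* ℂ => y.comp e = ψ₀).card := by
    have hM : 0 < finrank ℚ M := finrank_pos
    by_contra h0
    push Not at h0
    have : (Finset.univ.filter fun y : L →+* ℂ => y.comp e = ψ₀).card = 0 := by omega
    rw [this, zero_mul] at hcard
    omega
  obtain ⟨y, hy⟩ := Finset.card_pos.1 hpos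
  have hye : y.comp e = ψ₀ := (Finset.mem_filter.1 hy).2
  by_cases hyΘ : y ∈ Θ.1
  · exact ⟨y, fun y' hy' => (hψ₀ y y' hye (hy'.trans hye)).1 hyΘ, Or.inl hye⟩
  · refine ⟨(starRingAut : ℂ ≃+* ℂ) • y, fun y' hy' => ?_, Or.inr (by rw [← hye]; rfl)⟩
    -- `y'` lies over `ψ̄₀`, so `ȳ'` lies over `ψ₀` and is outside `Θ` like `y`
    have hCM := isCMTypeWith_conj Θ
    by_contra hy'Θ
    have h1 : (starRingAut : ℂ ≃+* ℂ) • y' ∈ Θ.1 := (hCM.rho_smul_mem_iff y').2 hy'Θ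
    have h2 : ((starRingAut : ℂ ≃+* ℂ) • y').comp e = ψ₀ := by
      have : ((starRingAut : ℂ ≃+* ℂ) • y').comp e = (starRingAut : ℂ ≃+* ℂ) • (y'.comp e) := rfl
      rw [this, hy', ← hye]
      change (starRingAut : ℂ ≃+* ℂ) • (starRingAut : ℂ ≃+* ℂ) • (y.comp e) = y.comp e
      rw [conj_smul_eq_conjugate, conj_smul_eq_conjugate]
      exact ComplexEmbedding.involutive_conjugate M _
    exact hyΘ ((hψ₀ _ y h2 hye).1 h1)

end Fields

/-! ## §2 The dichotomy on types -/

section Types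

variable {I : Type} {K : I → Type} [∀ i, Field (K i)] [∀ i, NumberField (K i)] [∀ i, IsCMField (K i)] [Fintype I]
  [DecidableEq I]
variable {M : Type} [Field M] [NumberField M] [IsCMField M]

omit [∀ i, IsCMField (K i)] [DecidableEq I] in
/-- `|⊔_i Hom(K_i, ℂ)| = Σ_i [K_i : ℚ]`. [folklore] -/
private theorem card_sigma_ringHom_eq_sum₁₈ :
    Fintype.card ((i : I) × (K i →+* ℂ)) = ∑ i, finrank ℚ (K i) := by
  rw [Fintype.card_sigma]
  exact Finset.sum_congr rfl fun i _ => Embeddings.card (K i) ℂ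

omit [DecidableEq I] in
/-- **DEGENERATE half.**  `M` a non-Galois quartic CM field (in the application: the reflex field of `K_{i₀}`),
`K_{i₁} ⊇ M` a non-Galois octic CM field, `ψ₀ : M → ℂ` unsplit for `Φ_{i₁}`; if every automorphism of `ℂ` fixing `ψ₀`
stabilises `Φ_{i₀}` (the reflex field of `(K_{i₀}, Φ_{i₀})` is `ψ₀(M)`), then `(Φ_{i₀}, Φ_{i₁})` is DEGENERATE — for a
nondegenerate `Φ_{i₁}` even `rank(Φ_{i₀}, Φ_{i₁}) = rank(Φ_{i₁})`. [cite: Gordon1999HodgeAVSurvey, 7.5–7.7]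
[cite: MoonenZarhin1999LowDim, "Hodge groups of simple abelian surfaces of CM-type"] -/
theorem not_isNondegenerateFamily_of_reflexSubfield_of_stabilizer {i₀ i₁ : I} (h01 : i₀ ≠ i₁)
    (hI : ∀ j, j = i₀ ∨ j = i₁) (Φ : ∀ i, CMType (K i)) (h4M : finrank ℚ M = 4) (hM : ¬ IsGalois ℚ M)
    (e : M →+* K i₁) (h8 : finrank ℚ (K i₁) = 8)
    (hK₁ : ¬ IsGalois ℚ (K i₁)) {ψ₀ : M →+* ℂ}
    (hψ₀ : ∀ y y' : K i₁ →+* ℂ, y.comp e = ψ₀ → y'.comp e = ψ₀ → (y ∈ (Φ i₁).1 ↔ y' ∈ (Φ i₁).1))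
    (hdeg : ∀ h : ℂ ≃+* ℂ, h • ψ₀ = ψ₀ → ∀ z : K i₀ →+* ℂ, h • z ∈ (Φ i₀).1 ↔ z ∈ (Φ i₀).1) :
    ¬ CMAlgebra.IsNondegenerateFamily Φ := by
  classical
  haveI : Nonempty I := ⟨i₀⟩
  intro hnd
  have hΘnd : IsNondegenerate (Φ i₁) := hnd.isNondegenerate i₁
  have h2 : finrank ℚ (K i₁) = 2 * finrank ℚ M := by rw [h8, h4M]
  have hout : ∀ y : K i₁ →+* ℂ, ¬ y.toRatAlgHom.fieldRange ≤ normalClosure ℚ M ℂ := fun y =>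
    not_fieldRange_le_normalClosure hK₁ (by rw [DihedralReflexPair.finrank_normalClosure_eq_eight h4M hM, h8]) y
  -- fibre mates
  choose ν hνX hνy using fun y : K i₁ →+* ℂ => exists_fibreSwap_of_not_le e h2 y (hout y)
  have hfib : ∀ y₁ y₂ y₃ : K i₁ →+* ℂ, y₁.comp e = y₂.comp e → y₂.comp e = y₃.comp e →
      y₁ = y₂ ∨ y₂ = y₃ ∨ y₁ = y₃ := forall_eq_or_eq_comp_eq e h2
  -- the unsplit fibre inside `Θ`, over `x₀ ∈ {ψ₀, ψ̄₀}`
  obtain ⟨y₀, hy₀Θ, hy₀e⟩ := exists_fibre_subset_of_unsplit e h2 (Φ i₁) hψ₀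
  have hdeg' : ∀ h : ℂ ≃+* ℂ, h • y₀.comp e = y₀.comp e → ∀ z : K i₀ →+* ℂ, h • z ∈ (Φ i₀).1 ↔ z ∈ (Φ i₀).1 := by
    intro h hh
    rcases hy₀e with he | he
    · rw [he] at hh; exact hdeg h hh
    · rw [he, smul_conj_smul_eq_iff] at hh; exact hdeg h hh
  -- the split fibre (Kubota)
  have hnd' : typeRank (ℂ ≃+* ℂ) (Φ i₁).1 = Fintype.card (K i₁ →+* ℂ) / 2 + 1 := by
    rw [Embeddings.card]; exact hΘnd
  obtain ⟨y₁, hy₁, hy₁'⟩ := exists_mem_and_mate_not_mem_of_typeRank_eq (isCMTypeWith_conj (Φ i₁))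
    (π := fun y : K i₁ →+* ℂ => y.comp e) (fun _ _ => rfl) hfib hνX hνy hnd'
  -- the four embeddings of `M`
  have hx₁₀ : y₁.comp e ≠ y₀.comp e := fun heq => hy₁' (hy₀Θ _ (by
    change (ν y₁ • y₁).comp e = y₀.comp e
    rw [← heq]; exact congrArg (· ) (by rw [show (ν y₁ • y₁).comp e = ν y₁ • (y₁.comp e) from rfl, hνX])))
  have hx₁₀' : y₁.comp e ≠ conjugate (y₀.comp e) := by
    intro heq
    have h1 : ((starRingAut : ℂ ≃+* ℂ) • y₁).comp e = y₀.comp e := by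
      change (starRingAut : ℂ ≃+* ℂ) • (y₁.comp e) = y₀.comp e
      rw [heq, conj_smul_eq_conjugate]; exact ComplexEmbedding.involutive_conjugate M _
    exact (isCMTypeWith_conj (Φ i₁)).rho_smul_mem_iff y₁ |>.1 (hy₀Θ _ h1) hy₁
  obtain ⟨y₀', hy₀'ne, hy₀'e⟩ := exists_ne_comp_eq e h2 y₀
  haveI := isPretransitive_ringEquiv_complex (K := M)
  have hlt := typeRank_sigmaType_lt_of_stabilizer_le (G := ℂ ≃+* ℂ) (E := fun i => K i →+* ℂ)
    (X := M →+* ℂ) (Φ := fun i => (Φ i).1) (fun i => isCMTypeWith_conj (Φ i)) h01 hI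
    (fun y : K i₁ →+* ℂ => y.comp e) (fun _ _ => rfl) hfib (x₀ := y₀.comp e)
    (fun x => MulAction.exists_smul_eq (ℂ ≃+* ℂ) (y₀.comp e) x) hdeg' (y₀ := y₀) (y₀' := y₀') rfl hy₀'e
    (Ne.symm hy₀'ne) (hy₀Θ y₀ rfl) (hy₀Θ y₀' hy₀'e) (y₁ := y₁) (y₁' := ν y₁ • y₁)
    (show (ν y₁ • y₁).comp e = y₁.comp e from by
      change ν y₁ • (y₁.comp e) = y₁.comp e; rw [hνX]) (Ne.symm (hνy y₁)) hy₁ hy₁'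
    (fun x => by
      have h := QuarticCM.eq_or_eq_or_eq_or_eq h4M hx₁₀ hx₁₀' x
      rwa [← conj_smul_eq_conjugate, ← conj_smul_eq_conjugate] at h)
  -- compare with nondegeneracy of the family
  rw [CMAlgebra.isNondegenerateFamily_iff, ← card_sigma_ringHom_eq_sum₁₈ (K := K)] at hnd
  exact absurd hnd (ne_of_lt hlt)

/-- **NONDEGENERATE half.**  Same fields; if `Φ_{i₁}` is nondegenerate and SOME automorphism of `ℂ` fixing the
unsplit embedding `ψ₀` MOVES `Φ_{i₀}` (the reflex field of `(K_{i₀}, Φ_{i₀})` is not `ψ₀(M)`), then `(Φ_{i₀}, Φ_{i₁})`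
is nondegenerate — by stabiliser separation with the separating element taken from `Stab(ψ₀)`.
[cite: MoonenZarhin1999LowDim, "Hodge groups of simple abelian surfaces of CM-type"] [cite: Gordon1999HodgeAVSurvey, 7.5] -/
theorem isNondegenerateFamily_of_reflexSubfield_of_not_stabilizer {i₀ i₁ : I} (h01 : i₀ ≠ i₁)
    (hI : ∀ j, j = i₀ ∨ j = i₁) (Φ : ∀ i, CMType (K i)) (h4 : finrank ℚ (K i₀) = 4) (hK₀ : ¬ IsGalois ℚ (K i₀))
    (h4M : finrank ℚ M = 4) (hM : ¬ IsGalois ℚ M) (hLL : normalClosure ℚ M ℂ = normalClosure ℚ (K i₀) ℂ)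
    (e : M →+* K i₁) (h8 : finrank ℚ (K i₁) = 8) (hK₁ : ¬ IsGalois ℚ (K i₁)) {ψ₀ : M →+* ℂ}
    (hψ₀ : ∀ y y' : K i₁ →+* ℂ, y.comp e = ψ₀ → y'.comp e = ψ₀ → (y ∈ (Φ i₁).1 ↔ y' ∈ (Φ i₁).1))
    (hmove : ∃ h : ℂ ≃+* ℂ, h • ψ₀ = ψ₀ ∧ ∃ z : K i₀ →+* ℂ, ¬(h • z ∈ (Φ i₀).1 ↔ z ∈ (Φ i₀).1))
    (hΘnd : IsNondegenerate (Φ i₁)) : CMAlgebra.IsNondegenerateFamily Φ := by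
  classical
  haveI : Nonempty I := ⟨i₀⟩
  have h2 : finrank ℚ (K i₁) = 2 * finrank ℚ M := by rw [h8, h4M]
  have hout : ∀ y : K i₁ →+* ℂ, ¬ y.toRatAlgHom.fieldRange ≤ normalClosure ℚ M ℂ := fun y =>
    not_fieldRange_le_normalClosure hK₁ (by rw [DihedralReflexPair.finrank_normalClosure_eq_eight h4M hM, h8]) y
  have hfib : ∀ y₁ y₂ y₃ : K i₁ →+* ℂ, y₁.comp e = y₂.comp e → y₂.comp e = y₃.comp e →
      y₁ = y₂ ∨ y₂ = y₃ ∨ y₁ = y₃ := forall_eq_or_eq_comp_eq e h2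
  obtain ⟨y₀, hy₀Θ, hy₀e⟩ := exists_fibre_subset_of_unsplit e h2 (Φ i₁) hψ₀
  obtain ⟨h₀, hh₀, hh₀Ψ⟩ := hmove
  have hh₀' : h₀ • y₀.comp e = y₀.comp e := by
    rcases hy₀e with he | he
    · rw [he]; exact hh₀
    · rw [he, smul_conj_smul_eq_iff]; exact hh₀
  have hnd' : typeRank (ℂ ≃+* ℂ) (Φ i₁).1 = Fintype.card (K i₁ →+* ℂ) / 2 + 1 := by
    rw [Embeddings.card]; exact hΘnd
  obtain ⟨g, hgΘ, z, hgz⟩ := exists_typeStab_and_not_of_quadraticTower_of_smul_eq (G := ℂ ≃+* ℂ)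
    (X := M →+* ℂ) (Y := K i₁ →+* ℂ) (Z := K i₀ →+* ℂ) (Ψ := (Φ i₀).1) (isCMTypeWith_conj (Φ i₁))
    (fun y : K i₁ →+* ℂ => y.comp e) (fun _ _ => rfl) hfib (fun y => exists_fibreSwap_of_not_le e h2 y (hout y))
    (fun n hn z => forall_smul_eq_of_forall_smul_eq_of_normalClosure_eq hLL hn z)
    (fun x x' hx' hx'' w => by
      rw [conj_smul_eq_conjugate] at hx'' ⊢; rw [conj_smul_eq_conjugate]
      exact QuarticCM.eq_or_eq_or_eq_or_eq h4M hx' hx'' w)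
    (y₀ := y₀) hy₀Θ hh₀' hh₀Ψ hnd'
  -- stabiliser separation at the quartic slot `i₀`
  have hI' : ∀ j, j = i₁ ∨ j = i₀ := fun j => (hI j).symm
  have key := typeRank_sigmaType_eq_iff_forall_of_stabSep_pair (G := ℂ ≃+* ℂ) (E := fun i => K i →+* ℂ)
    (Φ := fun i => (Φ i).1) (ρ := (starRingAut : ℂ ≃+* ℂ)) (g := g) i₀ (fun i => isCMTypeWith_conj (Φ i)) hI'
    h01.symm (fun i hi y => by
      rcases hI i with rfl | rfl
      · exact absurd rfl hi
      · exact hgΘ y) ⟨z, hgz⟩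
    (fun W hW hne hst => DihedralReflexPair.antiSpan_eq_of_stable h4 hK₀ (Φ i₀) W hW hne hst)
  have key' : CMAlgebra.IsNondegenerateFamily Φ ↔ ∀ i, IsNondegenerate (Φ i) := by
    rw [CMAlgebra.isNondegenerateFamily_iff, ← card_sigma_ringHom_eq_sum₁₈ (K := K)]
    refine key.trans (forall_congr' fun i => ?_)
    rw [isNondegenerate_iff, cmTypeRank, ← Embeddings.card (K i) ℂ]
  rw [key']
  intro i
  rcases hI i with rfl | rfl
  · exact QuarticCM.isNondegenerate_of_not_isGalois h4 hK₀ (Φ i)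
  · exact hΘnd

/-- **The dichotomy** (`ψ₀` unsplit for `Φ_{i₁}`): `(Φ_{i₀}, Φ_{i₁})` is nondegenerate iff `Φ_{i₁}` is nondegenerate and
some automorphism of `ℂ` fixing `ψ₀` moves `Φ_{i₀}` — a condition on the TYPES (it holds for the types of one
complex-conjugacy class of `K_{i₀}` and fails for the other). [cite: MoonenZarhin1999LowDim, Thm. (0.2)]
[cite: Gordon1999HodgeAVSurvey, 7.5–7.7] [cite: Shimura1998, §8.3 Prop. 28] -/
theorem isNondegenerateFamily_iff_of_reflexSubfield {i₀ i₁ : I} (h01 : i₀ ≠ i₁) (hI : ∀ j, j = i₀ ∨ j = i₁)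
    (Φ : ∀ i, CMType (K i)) (h4 : finrank ℚ (K i₀) = 4) (hK₀ : ¬ IsGalois ℚ (K i₀)) (h4M : finrank ℚ M = 4)
    (hM : ¬ IsGalois ℚ M) (hLL : normalClosure ℚ M ℂ = normalClosure ℚ (K i₀) ℂ) (e : M →+* K i₁)
    (h8 : finrank ℚ (K i₁) = 8) (hK₁ : ¬ IsGalois ℚ (K i₁)) {ψ₀ : M →+* ℂ}
    (hψ₀ : ∀ y y' : K i₁ →+* ℂ, y.comp e = ψ₀ → y'.comp e = ψ₀ → (y ∈ (Φ i₁).1 ↔ y' ∈ (Φ i₁).1)) :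
    CMAlgebra.IsNondegenerateFamily Φ ↔ IsNondegenerate (Φ i₁) ∧
      ∃ h : ℂ ≃+* ℂ, h • ψ₀ = ψ₀ ∧ ∃ z : K i₀ →+* ℂ, ¬(h • z ∈ (Φ i₀).1 ↔ z ∈ (Φ i₀).1) := by
  haveI : Nonempty I := ⟨i₀⟩
  refine ⟨fun hnd => ⟨hnd.isNondegenerate i₁, ?_⟩,
    fun ⟨hΘ, hmove⟩ => isNondegenerateFamily_of_reflexSubfield_of_not_stabilizer h01 hI Φ h4 hK₀ h4M hM hLL e h8
      hK₁ hψ₀ hmove hΘ⟩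
  by_contra hall
  push Not at hall
  exact not_isNondegenerateFamily_of_reflexSubfield_of_stabilizer h01 hI Φ h4M hM e h8 hK₁ hψ₀ hall hnd

end Types

/-! ## §3 Geometry: `S^a × F^b` -/

section Geometry

variable {I : Type} {K : I → Type} [∀ i, Field (K i)] [∀ i, NumberField (K i)] [∀ i, IsCMField (K i)] [Fintype I]
  [DecidableEq I] {Φ : ∀ i, CMType (K i)}
variable {A : I → AbelianVariety ℂ} {ι : ∀ i, 𝓞 (K i) →+* End (A i)}
  {θ : ∀ i, K i →+* Module.End ℂ (complexBetti (A i).X 1)}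
variable {M : Type} [Field M] [NumberField M] [IsCMField M]

/-- **The good conjugacy class: the Hodge conjecture and `B• = D•` on EVERY `S^a × F^b`**, UNCONDITIONALLY (`S` a CM
surface with non-Galois quartic field, `F` a realisation of a nondegenerate type of a non-Galois octic field containing
the reflex field `M` of `S`, some automorphism fixing the unsplit `ψ₀` moving the type of `S`).
[cite: Gordon1999HodgeAVSurvey, 7.5 and 10.10] [cite: MoonenZarhin1999LowDim, Thm. (0.2) (4)] -/
theorem hodgeConjectureFor_prod_of_reflexSubfield {i₀ i₁ : I} (h01 : i₀ ≠ i₁) (hI : ∀ j, j = i₀ ∨ j = i₁)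
    (h4 : finrank ℚ (K i₀) = 4) (hK₀ : ¬ IsGalois ℚ (K i₀)) (h4M : finrank ℚ M = 4) (hM : ¬ IsGalois ℚ M)
    (hLL : normalClosure ℚ M ℂ = normalClosure ℚ (K i₀) ℂ) (e : M →+* K i₁) (h8 : finrank ℚ (K i₁) = 8)
    (hK₁ : ¬ IsGalois ℚ (K i₁)) {ψ₀ : M →+* ℂ}
    (hψ₀ : ∀ y y' : K i₁ →+* ℂ, y.comp e = ψ₀ → y'.comp e = ψ₀ → (y ∈ (Φ i₁).1 ↔ y' ∈ (Φ i₁).1))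
    (hmove : ∃ h : ℂ ≃+* ℂ, h • ψ₀ = ψ₀ ∧ ∃ z : K i₀ →+* ℂ, ¬(h • z ∈ (Φ i₀).1 ↔ z ∈ (Φ i₀).1))
    (hΦ₁ : IsNondegenerate (Φ i₁)) (hA : ∀ i, IsCMTypeRealisation (Φ i) (A i) (ι i) (θ i)) {N : ℕ}
    (π : Fin N → I) :
    HodgeConjectureFor (⨁ fun j : Fin N => A (π j)).dim (⨁ fun j : Fin N => A (π j)).X ∧
      ∀ m : ℕ, hodgeClassSpan (⨁ fun j : Fin N => A (π j)).dim (⨁ fun j : Fin N => A (π j)).X m =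
        divisorClassesSpan (⨁ fun j : Fin N => A (π j)).X (⨁ fun j : Fin N => A (π j)).dim m :=
  haveI : Nonempty I := ⟨i₀⟩
  have hnd := isNondegenerateFamily_of_reflexSubfield_of_not_stabilizer h01 hI Φ h4 hK₀ h4M hM hLL e h8 hK₁ hψ₀
    hmove hΦ₁
  ⟨hnd.hodgeConjectureFor_prod hA π, fun m => hnd.hodgeClassSpan_prod_eq_divisorClassesSpan hA π m⟩

/-- **The bad conjugacy class: an exceptional Hodge class on some `S^a × F^b`** (`S`, `F` simple realisations; the
automorphisms fixing the unsplit `ψ₀` stabilise the type of `S`) — whatever the type of `F`.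
[cite: Gordon1999HodgeAVSurvey, 7.5] [cite: MoonenZarhin1999LowDim, Thm. (0.2) (a)] -/
theorem exists_exceptional_prod_of_reflexSubfield {i₀ i₁ : I} (h01 : i₀ ≠ i₁) (hI : ∀ j, j = i₀ ∨ j = i₁)
    (h4 : finrank ℚ (K i₀) = 4) (h4M : finrank ℚ M = 4) (hM : ¬ IsGalois ℚ M) (e : M →+* K i₁)
    (h8 : finrank ℚ (K i₁) = 8)
    (hK₁ : ¬ IsGalois ℚ (K i₁)) {ψ₀ : M →+* ℂ}
    (hψ₀ : ∀ y y' : K i₁ →+* ℂ, y.comp e = ψ₀ → y'.comp e = ψ₀ → (y ∈ (Φ i₁).1 ↔ y' ∈ (Φ i₁).1))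
    (hdeg : ∀ h : ℂ ≃+* ℂ, h • ψ₀ = ψ₀ → ∀ z : K i₀ →+* ℂ, h • z ∈ (Φ i₀).1 ↔ z ∈ (Φ i₀).1)
    (hA : ∀ i, IsCMTypeRealisation (Φ i) (A i) (ι i) (θ i)) (hs : ∀ i, (A i).IsSimple) :
    ∃ (N : ℕ) (π : Fin N → I) (m : ℕ) (c : complexBetti (⨁ fun j : Fin N => A (π j)).X (2 * m)),
      IsRationalClass c ∧
      IsOfHodgeType (⨁ fun j : Fin N => A (π j)).dim (⨁ fun j : Fin N => A (π j)).X (2 * m) m m c ∧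
      c ∉ divisorClassesSpan (⨁ fun j : Fin N => A (π j)).X (⨁ fun j : Fin N => A (π j)).dim m := by
  haveI : Nonempty I := ⟨i₀⟩
  refine CMAlgebra.exists_exceptional_prod_of_not_isNondegenerateFamily
    (isSeparatingFamily_of_isSimple_of_finrank_injective hA hs fun i j hij => ?_)
    (not_isNondegenerateFamily_of_reflexSubfield_of_stabilizer h01 hI Φ h4M hM e h8 hK₁ hψ₀ hdeg) hA
  rcases hI i with rfl | rfl <;> rcases hI j with rfl | rfl
  · rfl
  · rw [h4, h8] at hij; omega
  · rw [h4, h8] at hij; omega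
  · rfl

end Geometry

end Summit.HodgeConjecture.CorCM

end
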